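import Summits.CriticalPhenomena.SAWScalingLimit.Theorems.HexTight.Negative.RingDegree

/-!
# Ring counterexamples for crux `HexTight` (stmt-CriticalPhenomena-5423), part 6:
the ring as a discrete domain `Ω_1`

`Ω = ⋃_{v ∈ ring K} B(c(v), 3/10)` (`Omega K`). Two faces whose centres are within `3/10` coincide
(`eq_of_dist_le`, via the integer coordinates `cA`, `cB` of a centre), so the mesh-`1` vertices of `Ω`
are exactly the ring cells (`mem_meshVertices`); an edge has length `1/√3 < 3/5`, so the segment
between adjacent ring centres is covered by the two discs (`segment_subset_Omega`, `meshAdj_of_adj`);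
every ring cell is joined to the centre inside the ring (`joined_of_mem_ring`, from the routes of part
3), so the mesh vertex graph is connected and the discrete domain `Ω_1` (largest component) is the
whole ring (`mem_meshDomain`), with adjacency = lattice adjacency of ring cells (`domAdj_iff`); lattice
paths in the ring transfer to `Ω_1` (`domWalk_of_latticeJoined`); SAWs of `Ω_1` are finitely many
(`finite_saw`, `fintype_saw`). Used by `Negative/OutwardDiveFalse.lean`.
-/

noncomputable section

open scoped BigOperators
open Classical
open Literature.Probability.LatticeModels
open Literature.Probability.RandomPlanarGeometry.SAW

namespace Summit.CriticalPhenomena.SAWScalingLimit.Cruxes.HexTight.Negative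

/-! ## Part 6 — realising the ring as a discrete domain `Ω_1`

`Ω = ⋃_{v ∈ ring K} B(c(v), 3/10)`: its mesh-`1` vertices are exactly the ring cells (distinct
face centres are `≥ 1/√3 > 3/5` apart), adjacent ring cells are mesh-adjacent (an edge has length
`1/√3 < 3/5`, so the segment is covered by the two discs), the ring is connected, hence the discrete
domain `Ω_1` is the ring with its induced adjacency. -/

section Domain

open Literature.Probability.RandomPlanarGeometry

/-- twice the real part of a face centre (an integer) -/
def cA (v : HexVertex) : ℤ := 2 * v.1 0 + v.1 1 + (v.2 : ℕ) + 1

/-- `6/√3` times the imaginary part of a face centre (an integer) -/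
def cB (v : HexVertex) : ℤ := 3 * v.1 1 + (v.2 : ℕ) + 1

/-- real part in terms of `cA` -/
theorem re_eq_cA (v : HexVertex) : (hexCenter v).re = (cA v : ℝ) / 2 := by
  rcases v with ⟨x, k⟩
  simp [hexCenter, triEmbed, cA]
  ring

/-- imaginary part in terms of `cB` -/
theorem im_eq_cB (v : HexVertex) : (hexCenter v).im = Real.sqrt 3 * (cB v : ℝ) / 6 := by
  rcases v with ⟨x, k⟩
  simp [hexCenter, triEmbed, cB]
  ring

/-- **Two faces whose centres are within `3/10` of each other coincide.** -/
theorem eq_of_dist_le {y v : HexVertex} (h : dist (hexCenter y) (hexCenter v) ≤ 3 / 10) : y = v := by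
  have h13 := one_le_sqrt3
  rw [Complex.dist_eq] at h
  have hre : |(hexCenter y).re - (hexCenter v).re| ≤ 3 / 10 :=
    le_trans (by rw [← Complex.sub_re]; exact Complex.abs_re_le_norm _) h
  have him : |(hexCenter y).im - (hexCenter v).im| ≤ 3 / 10 :=
    le_trans (by rw [← Complex.sub_im]; exact Complex.abs_im_le_norm _) h
  rw [re_eq_cA, re_eq_cA, abs_le] at hre
  rw [im_eq_cB, im_eq_cB] at him
  have ha1 : cA y - cA v < 1 := by
    have : ((cA y : ℝ) - cA v) < 1 := by linarith [hre.2]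
    exact_mod_cast this
  have ha2 : -1 < cA y - cA v := by
    have : (-1 : ℝ) < (cA y : ℝ) - cA v := by linarith [hre.1]
    exact_mod_cast this
  have hd : Real.sqrt 3 * (cB y : ℝ) / 6 - Real.sqrt 3 * (cB v : ℝ) / 6 =
      (Real.sqrt 3 / 6) * ((cB y : ℝ) - cB v) := by ring
  rw [hd, abs_mul, abs_of_pos (by positivity)] at him
  have hb0 : |(cB y : ℝ) - cB v| ≤ Real.sqrt 3 * |(cB y : ℝ) - cB v| := by
    nlinarith [abs_nonneg ((cB y : ℝ) - cB v)]
  have hb : |(cB y : ℝ) - cB v| < 2 := by nlinarith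
  rw [abs_lt] at hb
  have hb1 : cB y - cB v < 2 := by
    have : ((cB y : ℝ) - cB v) < 2 := hb.2
    exact_mod_cast this
  have hb2 : -2 < cB y - cB v := by
    have : (-2 : ℝ) < (cB y : ℝ) - cB v := hb.1
    exact_mod_cast this
  obtain ⟨x, k⟩ := y
  obtain ⟨x', k'⟩ := v
  simp only [cA, cB] at ha1 ha2 hb1 hb2
  have hk : (k : ℕ) ≤ 1 := Nat.lt_succ_iff.1 k.isLt
  have hk' : (k' : ℕ) ≤ 1 := Nat.lt_succ_iff.1 k'.isLt
  have hall : x 0 = x' 0 ∧ x 1 = x' 1 ∧ (k : ℕ) = (k' : ℕ) := by omega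
  obtain ⟨h0, h1, h2⟩ := hall
  have hx : x = x' := by
    rw [site_eq x, site_eq x', h0, h1]
  rw [hx, Fin.ext h2]

/-- **The domain realising the ring**: small discs about the ring centres. -/
def Omega (K : ℕ) : Set ℂ := ⋃ v ∈ (ring K : Set HexVertex), Metric.ball (hexCenter v) (3 / 10)

/-- `Ω` is bounded -/
theorem isBounded_Omega (K : ℕ) : Bornology.IsBounded (Omega K) :=
  Bornology.isBounded_biUnion (ring K).finite_toSet |>.2 fun _ _ => Metric.isBounded_ball

/-- a centre lies in `Ω` iff the face is a ring cell -/
theorem center_mem_Omega {K : ℕ} {y : HexVertex} : hexCenter y ∈ Omega K ↔ y ∈ ring K := by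
  constructor
  · intro h
    simp only [Omega, Set.mem_iUnion, Metric.mem_ball, Finset.mem_coe] at h
    obtain ⟨v, hv, hdist⟩ := h
    rw [eq_of_dist_le (y := y) (v := v) hdist.le]
    exact hv
  · intro h
    simp only [Omega, Set.mem_iUnion, Metric.mem_ball, Finset.mem_coe]
    exact ⟨y, h, by simp⟩

/-- **the mesh-`1` vertices of `Ω` are the ring cells** -/
theorem mem_meshVertices {K : ℕ} {y : HexVertex} :
    y ∈ embMeshVertices hexCenter (Omega K) 1 ↔ y ∈ ring K := by
  rw [mem_embMeshVertices_iff, Complex.ofReal_one, one_mul, center_mem_Omega]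

/-- adjacent faces have centres `< 3/5` apart (edge length `1/√3`) -/
theorem dist_lt_of_adj {a b : HexVertex} (h : hexGraph.Adj a b) :
    dist (hexCenter a) (hexCenter b) < 3 / 5 := by
  have key : ∀ {x y : Site 2}, hexGraph.Adj (x, 0) (y, 1) →
      dist (hexCenter (x, 0)) (hexCenter (y, 1)) < 3 / 5 := by
    intro x y hxy
    have h2 := (re_sub_re_of_adj_UD hxy).2
    rw [Complex.dist_eq, ← sq_lt_sq₀ (norm_nonneg _) (by norm_num), Complex.sq_norm, h2]
    norm_num
  obtain ⟨x, k⟩ := a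
  obtain ⟨y, l⟩ := b
  fin_cases k <;> fin_cases l
  · exact absurd h (not_hexGraph_adj_of_snd_eq_holds _ _ rfl)
  · exact key h
  · rw [dist_comm]; exact key h.symm
  · exact absurd h (not_hexGraph_adj_of_snd_eq_holds _ _ rfl)

/-- **the segment between adjacent ring centres lies in `Ω`** (covered by the two discs) -/
theorem segment_subset_Omega {K : ℕ} {u v : HexVertex} (huv : hexGraph.Adj u v) (hu : u ∈ ring K)
    (hv : v ∈ ring K) : segment ℝ (hexCenter u) (hexCenter v) ⊆ Omega K := by
  intro z hz
  rw [segment_eq_image'] at hz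
  obtain ⟨t, ⟨ht0, ht1⟩, rfl⟩ := hz
  have hd := dist_lt_of_adj huv
  rw [dist_comm, Complex.dist_eq] at hd
  simp only [Omega, Set.mem_iUnion, Metric.mem_ball, Finset.mem_coe]
  rcases le_or_gt t (1 / 2) with ht | ht
  · refine ⟨u, hu, ?_⟩
    rw [dist_eq_norm, add_sub_cancel_left, norm_smul, Real.norm_eq_abs, abs_of_nonneg ht0]
    nlinarith [norm_nonneg (hexCenter v - hexCenter u)]
  · refine ⟨v, hv, ?_⟩
    have : hexCenter u + t • (hexCenter v - hexCenter u) - hexCenter v =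
        (1 - t) • (hexCenter u - hexCenter v) := by
      simp only [smul_sub, sub_smul, one_smul]; abel
    rw [dist_eq_norm, this, norm_smul, Real.norm_eq_abs, abs_of_nonneg (by linarith), norm_sub_rev]
    nlinarith [norm_nonneg (hexCenter v - hexCenter u)]

/-- adjacent ring cells are adjacent in the mesh graph of `Ω` -/
theorem meshAdj_of_adj {K : ℕ} {u v : HexVertex} (huv : hexGraph.Adj u v) (hu : u ∈ ring K)
    (hv : v ∈ ring K) : (embMeshGraph hexGraph hexCenter (Omega K) 1).Adj u v := by
  refine (embMeshGraph_adj_iff _ _).2 ⟨huv, ?_⟩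
  rw [Complex.ofReal_one, one_mul, one_mul]
  exact (segment_subset_Omega huv hu hv).trans subset_closure

/-! ### every ring cell is joined to the centre inside the ring -/

/-- `Tpos` is part of the ring -/
theorem Tpos_subset {K : ℕ} : Tpos K ⊆ (ring K : Set HexVertex) := fun _ hy => Finset.mem_coe.2 hy.1

/-- `Tneg` is part of the ring -/
theorem Tneg_subset {K : ℕ} : Tneg K ⊆ (ring K : Set HexVertex) := fun _ hy => Finset.mem_coe.2 hy.1

section Coverage

variable {K : ℕ} (hK : 1 ≤ K)
include hK

/-- the up faces of the ring are joined to the centre -/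
theorem joined_U {i j : ℤ} (h : U i j ∈ ring K) :
    LatticeJoined (ring K : Set HexVertex) (U 0 0) (U i j) := by
  have hb : ∀ n : ℕ, (n : ℤ) ≤ K → LatticeJoined (ring K : Set HexVertex) (U 0 0) (U n 0) :=
    fun n hn => ((joined_right_bottom hK n hn).latticeJoined).mono Tpos_subset
  have hcol : ∀ m : ℕ, m ≤ 2 * K → LatticeJoined (ring K : Set HexVertex) (U 0 0) (U K m) :=
    fun m hm => (hb K le_rfl).trans (((joined_right_col hK m hm).latticeJoined).mono Tpos_subset)
  have hcorner : LatticeJoined (ring K : Set HexVertex) (U 0 0) (U (-(3 * K : ℤ)) (2 * K)) := by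
    obtain ⟨n₁, hn₁⟩ : ∃ n : ℕ, (n : ℤ) = 3 * K - 1 := ⟨3 * K - 1, by omega⟩
    obtain ⟨n₂, hn₂⟩ : ∃ n : ℕ, (n : ℤ) = 2 * K - 1 := ⟨2 * K - 1, by omega⟩
    have h1 := joined_left_bottom hK n₁ (by omega)
    have h2 := joined_left_col hK n₂ (by omega)
    rw [hn₁, show -(3 * (K : ℤ) - 1) - 1 = -(3 * K) by ring] at h1
    rw [hn₂, sub_add_cancel] at h2
    exact (h1.trans h2).mono Tneg_subset
  rcases U_mem_ring.1 h with ⟨hj, hi1, hi2⟩ | ⟨hi, hj1, hj2⟩ | ⟨hj, hi1, hi2⟩ | ⟨hi, hj1, hj2⟩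
  · -- bottom row
    subst hj
    rcases le_or_gt 0 i with hi | hi
    · obtain ⟨n, rfl⟩ : ∃ n : ℕ, (n : ℤ) = i := ⟨i.toNat, by omega⟩
      exact hb n hi2
    · obtain ⟨n, hn⟩ : ∃ n : ℕ, -(n : ℤ) - 1 = i := ⟨(-i - 1).toNat, by omega⟩
      have h1 := (joined_left_bottom hK n (by omega)).mono Tneg_subset
      rw [hn] at h1
      exact h1.step (adj_U_D _ _).symm (Finset.mem_coe.2 h)
  · -- right column
    subst hi
    obtain ⟨m, rfl⟩ : ∃ m : ℕ, (m : ℤ) = j := ⟨j.toNat, by omega⟩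
    exact hcol m (by omega)
  · -- top row
    subst hj
    rcases le_or_gt 0 i with hi | hi
    · obtain ⟨n, hn⟩ : ∃ n : ℕ, (K : ℤ) - n = i := ⟨(K - i).toNat, by omega⟩
      have h3 := ((joined_right_top hK n (by omega)).latticeJoined).mono Tpos_subset
      rw [hn] at h3
      have h2 := hcol (2 * K) le_rfl
      push_cast at h2
      exact h2.trans h3
    · obtain ⟨n, hn⟩ : ∃ n : ℕ, -(3 * K : ℤ) + n = i := ⟨(i + 3 * K).toNat, by omega⟩
      have h3 := (joined_left_top hK n (by omega)).mono Tneg_subset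
      rw [hn] at h3
      exact hcorner.trans h3
  · -- left column
    subst hi
    obtain ⟨m, hm⟩ : ∃ m : ℕ, (m : ℤ) + 1 = j := ⟨(j - 1).toNat, by omega⟩
    obtain ⟨n₁, hn₁⟩ : ∃ n : ℕ, (n : ℤ) = 3 * K - 1 := ⟨3 * K - 1, by omega⟩
    have h1 := joined_left_bottom hK n₁ (by omega)
    rw [hn₁, show -(3 * (K : ℤ) - 1) - 1 = -(3 * K) by ring] at h1
    have h2 := joined_left_col hK m (by omega)
    rw [hm] at h2
    exact (h1.trans h2).mono Tneg_subset

/-- **every ring cell is joined to the centre `U(0,0)` inside the ring** -/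
theorem joined_of_mem_ring {y : HexVertex} (h : y ∈ ring K) :
    LatticeJoined (ring K : Set HexVertex) (U 0 0) y := by
  rcases face_eq y with hy | hy
  · rw [hy] at h ⊢; exact joined_U hK h
  · rw [hy] at h ⊢
    set i := y.1 0
    set j := y.1 1
    rcases D_mem_ring.1 h with ⟨hj, hi1, hi2⟩ | ⟨hi, hj1, hj2⟩ | ⟨hj, hi1, hi2⟩ | ⟨hi, hj1, hj2⟩
    · rw [hj]
      rw [hj] at h
      rcases le_or_gt 0 i with hi | hi
      · have hU : U i 0 ∈ ring K := U_mem_ring.2 (Or.inl ⟨rfl, by omega, hi2⟩)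
        exact (joined_U hK hU).step (adj_U_D _ _) (Finset.mem_coe.2 h)
      · obtain ⟨n, hn⟩ : ∃ n : ℕ, -(n : ℤ) - 1 = i := ⟨(-i - 1).toNat, by omega⟩
        have h1 := (joined_left_bottom hK n (by omega)).mono Tneg_subset
        rwa [hn] at h1
    · have hU : U i j ∈ ring K := U_mem_ring.2 (Or.inr (Or.inl ⟨hi, hj1, by omega⟩))
      exact (joined_U hK hU).step (adj_U_D _ _) (Finset.mem_coe.2 h)
    · have hU : U i j ∈ ring K := U_mem_ring.2 (Or.inr (Or.inr (Or.inl ⟨hj, hi1, hi2⟩)))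
      exact (joined_U hK hU).step (adj_U_D _ _) (Finset.mem_coe.2 h)
    · have hU : U i j ∈ ring K := U_mem_ring.2 (Or.inr (Or.inr (Or.inr ⟨hi, hj1, hj2⟩)))
      exact (joined_U hK hU).step (adj_U_D _ _) (Finset.mem_coe.2 h)

end Coverage

/-- a lattice path inside the ring is a path of the mesh vertex graph of `Ω` -/
theorem meshReachable {K : ℕ} {u v : HexVertex} (hu : u ∈ embMeshVertices hexCenter (Omega K) 1)
    (hv : v ∈ embMeshVertices hexCenter (Omega K) 1)
    (h : LatticeJoined (ring K : Set HexVertex) u v) :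
    (embMeshVertexGraph hexGraph hexCenter (Omega K) 1).Reachable ⟨u, hu⟩ ⟨v, hv⟩ := by
  obtain ⟨p, hp⟩ := h
  induction p with
  | nil => exact SimpleGraph.Reachable.refl _
  | @cons a b c hab p ih =>
    have hb : b ∈ ring K := Finset.mem_coe.1 (hp b (List.mem_cons_of_mem _ p.start_mem_support))
    have hb' : b ∈ embMeshVertices hexCenter (Omega K) 1 := mem_meshVertices.2 hb
    have ha : a ∈ ring K := mem_meshVertices.1 hu
    refine SimpleGraph.Reachable.trans (SimpleGraph.Adj.reachable ?_)
      (ih hb' hv fun y hy => hp y (List.mem_cons_of_mem _ hy))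
    simp only [SimpleGraph.comap_adj, Function.Embedding.subtype_apply]
    exact meshAdj_of_adj hab ha hb

/-- **the mesh vertex graph of `Ω` is connected** -/
theorem preconnected_mesh {K : ℕ} (hK : 1 ≤ K) :
    (embMeshVertexGraph hexGraph hexCenter (Omega K) 1).Preconnected := by
  rintro ⟨u, hu⟩ ⟨v, hv⟩
  have h0 : U 0 0 ∈ embMeshVertices hexCenter (Omega K) 1 :=
    mem_meshVertices.2 (U_mem_ring.2 (Or.inl ⟨rfl, by omega, by omega⟩))
  have h1 := meshReachable h0 hu (joined_of_mem_ring hK (mem_meshVertices.1 hu))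
  have h2 := meshReachable h0 hv (joined_of_mem_ring hK (mem_meshVertices.1 hv))
  exact h1.symm.trans h2

/-- **the discrete domain `Ω_1` is the whole ring** -/
theorem mem_meshDomain {K : ℕ} (hK : 1 ≤ K) {v : HexVertex} :
    v ∈ embMeshDomain hexGraph hexCenter (Omega K) 1 ↔ v ∈ ring K := by
  constructor
  · intro h; exact mem_meshVertices.1 (embMeshDomain_subset _ _ _ _ h)
  · intro hv
    have hv' := mem_meshVertices.2 hv
    have hsub := (preconnected_mesh hK).subsingleton_connectedComponent
    simp only [embMeshDomain, Set.mem_iUnion, Set.mem_image]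
    refine ⟨(embMeshVertexGraph hexGraph hexCenter (Omega K) 1).connectedComponentMk ⟨v, hv'⟩,
      fun C' => ?_, ⟨v, hv'⟩, ?_, rfl⟩
    · rw [Subsingleton.elim C'
        ((embMeshVertexGraph hexGraph hexCenter (Omega K) 1).connectedComponentMk ⟨v, hv'⟩)]
    · rw [SimpleGraph.ConnectedComponent.mem_supp_iff]

/-- adjacency of `Ω_1` implies lattice adjacency of two ring cells -/
theorem domAdj_imp {K : ℕ} {u v : HexVertex} (h : (hexDomainGraph (Omega K) 1).Adj u v) :
    hexGraph.Adj u v ∧ u ∈ ring K ∧ v ∈ ring K := by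
  rw [hexDomainGraph, embDomainGraph_adj_iff] at h
  exact ⟨embMeshGraph_le _ _ _ _ h.1, mem_meshVertices.1 (embMeshDomain_subset _ _ _ _ h.2.1),
    mem_meshVertices.1 (embMeshDomain_subset _ _ _ _ h.2.2)⟩

/-- **adjacency of `Ω_1` is lattice adjacency of ring cells** -/
theorem domAdj_iff {K : ℕ} (hK : 1 ≤ K) {u v : HexVertex} :
    (hexDomainGraph (Omega K) 1).Adj u v ↔ hexGraph.Adj u v ∧ u ∈ ring K ∧ v ∈ ring K := by
  refine ⟨domAdj_imp, ?_⟩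
  rintro ⟨h, hu, hv⟩
  rw [hexDomainGraph, embDomainGraph_adj_iff, mem_meshDomain hK, mem_meshDomain hK]
  exact ⟨meshAdj_of_adj h hu hv, hu, hv⟩

/-- a lattice path inside a part `S` of the ring is a path of `Ω_1` inside `S` -/
theorem domWalk_of_latticeJoined {K : ℕ} (hK : 1 ≤ K) {S : Set HexVertex}
    (hS : S ⊆ (ring K : Set HexVertex)) {u v : HexVertex} (h : LatticeJoined S u v) :
    ∃ p : (hexDomainGraph (Omega K) 1).Walk u v, ∀ y ∈ p.support, y ∈ S := by
  obtain ⟨p, hp⟩ := h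
  induction p with
  | nil => exact ⟨SimpleGraph.Walk.nil, by simpa using hp⟩
  | @cons a b c hab p ih =>
    have ha : a ∈ S := hp a (by simp)
    have hb : b ∈ S := hp b (List.mem_cons_of_mem _ p.start_mem_support)
    obtain ⟨q, hq⟩ := ih fun y hy => hp y (List.mem_cons_of_mem _ hy)
    have hadj : (hexDomainGraph (Omega K) 1).Adj a b :=
      (domAdj_iff hK).2 ⟨hab, Finset.mem_coe.1 (hS ha), Finset.mem_coe.1 (hS hb)⟩
    refine ⟨SimpleGraph.Walk.cons hadj q, fun y hy => ?_⟩
    rw [SimpleGraph.Walk.support_cons, List.mem_cons] at hy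
    rcases hy with rfl | hy
    · exact ha
    · exact hq y hy

/-- the vertices of a walk of `Ω_1` from a ring cell are ring cells -/
theorem support_subset_ring {K : ℕ} {u v : HexVertex} (hu : u ∈ ring K)
    (p : (hexDomainGraph (Omega K) 1).Walk u v) : ∀ y ∈ p.support, y ∈ ring K := by
  induction p with
  | nil => simpa using hu
  | @cons a b c hab p ih =>
    intro y hy
    rw [SimpleGraph.Walk.support_cons, List.mem_cons] at hy
    rcases hy with rfl | hy
    · exact hu
    · exact ih (domAdj_imp hab).2.2 y hy

/-- the vertices of a SAW of `Ω_1` lie in the ring, apart possibly from a lone isolated start -/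
theorem support_subset_insert {K : ℕ} {a b : HexVertex} (γ : HexDomainSAW (Omega K) 1 a b) :
    ∀ y ∈ γ.walk.support, y ∈ insert a (ring K) := by
  obtain ⟨w, hw⟩ := γ
  cases w with
  | nil => intro y hy; simp only [SimpleGraph.Walk.support_nil, List.mem_singleton] at hy; simp [hy]
  | cons hadj p =>
    intro y hy
    exact Finset.mem_insert_of_mem
      (support_subset_ring (domAdj_imp hadj).2.1 (SimpleGraph.Walk.cons hadj p) y hy)

/-- there are finitely many SAWs of `Ω_1` between two cells -/
instance finite_saw {K : ℕ} (a b : HexVertex) : Finite (HexDomainSAW (Omega K) 1 a b) := by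
  classical
  refine Finite.of_injective (fun γ : HexDomainSAW (Omega K) 1 a b =>
    (⟨γ.walk.support.attachWith _ (support_subset_insert γ), ?_⟩ :
      {l : List ↥(insert a (ring K)) // l.Nodup})) ?_
  · refine List.Nodup.of_map Subtype.val ?_
    rw [List.attachWith_map_subtype_val]
    exact γ.isPath.support_nodup
  · intro γ γ' h
    have h' := congrArg (fun l : {l : List ↥(insert a (ring K)) // l.Nodup} => l.1.map Subtype.val) h
    simp only [List.attachWith_map_subtype_val] at h'
    obtain ⟨w, hw⟩ := γ
    obtain ⟨w', hw'⟩ := γ'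
    simp only at h'
    cases SimpleGraph.Walk.ext_support h'
    rfl

/-- `Fintype` structure on the SAWs of `Ω_1` (noncomputable) -/
noncomputable instance fintype_saw {K : ℕ} (a b : HexVertex) :
    Fintype (HexDomainSAW (Omega K) 1 a b) :=
  Fintype.ofFinite _

end Domain



end Summit.CriticalPhenomena.SAWScalingLimit.Cruxes.HexTight.Negative

end
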